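import Literature.Analysis.FluidPDE.GKPCriticalElementsPathSpace
import Literature.Analysis.FunctionSpaces.BesovWeakStarCompactness
import HarnessLib

/-!
# GKP Proposition 2.2 over Gallagher–Koch–Planchon's own solution class

Sibling file of `Literature/Analysis/FluidPDE/GKPCriticalElements.lean` (named fact
`Literature.Analysis.FluidPDE.gkp_criticalElement_tendsto_zero` = Gallagher–Koch–Planchon 2016,
Prop. 2.2, "compactness at blow-up time of critical elements"), of
`GKPCriticalElementsProofs.lean` (where that fact is derived from Theorem 1:
`gkp_criticalElement_tendsto_zero_of_gkp_besov_blowup`, `gkp_besov_blowup_iff_gkp`) and of the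
audit files `GKPRegularityPersistence.lean` (GKP's path-space class `MemGKPPathSpace` =
`𝓛^{1:∞}_{p,q}[T' < T]`) and `GKPCriticalElementsPathSpace.lean` (Prop. 2.1 over that class). It
completes the audit for Prop. 2.2: it writes down the statement transported to GKP's own class and
proves that the vendored fact is that statement **plus** the standing identification of the tree's
solution class with `NS(u₀)`. Theorems only: no definition, no named fact, nothing in the sibling
files changes.

## What is printed (arXiv:1407.4156, p. 6; proof in §2.4, pp. 8–9)

With `NS(u₀)` "the unique strong Navier–Stokes solution" of the Duhamel equation (1.2) in the
path space `X_T = 𝓛^{1:∞}_{p,q}(T)` and `T*(u₀) = T*_{𝓛^{1:∞}_{p,q}(T)}(u₀)` (p. 4), under the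
standing assumption `p = q = 3·2^k - 2`, `k ≥ 2`, and with
`A_c = sup {A > 0 | sup_{[0,T*(u₀))} ‖NS(u₀)(t)‖ ≤ A ⟹ T*(u₀) = ∞ ∀ u₀}`
(`= inf {sup_{[0,T*(u₀))} ‖NS(u₀)(t)‖ | T*(u₀) < ∞}` when finite) and
`𝒟_c = {u₀ | T*(u₀) < ∞ and sup_{[0,T*(u₀))} ‖NS(u₀)(t)‖ = A_c < ∞}` (§2.1, p. 6):
**Proposition 2.2.** *If `A_c < ∞`, then any `u₀` in `𝒟_c` satisfies `NS(u₀)(t) → 0` in `𝓢'`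
as `t ↗ T*(u₀)`.* The printed proof (§2.4) goes through `NS(·)` at every step: the data
`u_{0,n} := u_c(s_n)`, `s_n ↗ T*(u_{0,c})`, have lifespans `T*(u_{0,n}) = T*(u_{0,c}) - s_n` and
bounds "`A_n ≡ A_c`" *because* `NS(u_c(s_n)) = u_c(s_n + ·)` (uniqueness in `𝓛^{1:∞}`, p. 4);
Theorem 3 is the `NS`-evolution of the profile decomposition of `(u_{0,n})`; Prop. 2.6 places
`NS(φ₁)` in `𝒟_c`; the orthogonality (2.12) isolates the weak-limit profile.

## What the vendored statement says instead

`gkp_criticalElement_tendsto_zero` quantifies over the tree's class: a critical element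
(`IsCriticalElement ν p T u U`) is an `IsMaximalBesovMildSolution` solution (duality-form mild
identity from `t = 0`, Kato's class `K_∞`, `C([0,T); Ḃ^{s_p}_{p,p})` through the distributions
of the slices, no extension *in that class*) with finite lifespan `T` realising
`criticalBesovThreshold ν p`, itself an infimum over **all** such solutions
(`criticalBesovThreshold_eq_iInf`). Exactly as for Prop. 2.1 (module docstring of
`GKPCriticalElementsPathSpace.lean`, which applies word for word), the two statements agree under
the standing identification of `CriticalRegularity.lean` — every member of the tree's class lies
in GKP's path space, hypothesis `hId` below, under which the two maximal times and the two
thresholds coincide (`isMaximalBesovMildSolution_iff_pathSpace`,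
`criticalBesovThreshold_eq_iInf_pathSpace`) — and that identification is **not** a published
result (audit in `GKPRegularityPersistence.lean`: continuity in the critical Besov space is not a
uniqueness class, Fujii 2026, Thm. 1.2; the printed uniqueness theorems for Kato-type classes need
an `L²`-in-time integrability at `t = 0`, Miura 2005, Thm. 2.3). Without `hId`, §2.4 says nothing
about a member of the tree's class that is not `NS(u 0)`, and the two thresholds are infima over a
priori different classes, so neither implication between the vendored and the printed Prop. 2.2
is available. Nothing here asserts that the vendored statement is false; given Theorem 1 in the
tree's rendering (`gkp_besov_blowup`) it holds
(`gkp_criticalElement_tendsto_zero_of_gkp_besov_blowup`).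

## The statement over GKP's class (hypothesis `hP`; for a later `definition` proposal, D-0026)

With "GKP solution on `[0, T)`" :=
`IsBesovMildSolutionOn (-1+3/p) p p T ν u U ∧ MemGKPPathSpace p p T U` and "`T = T*`" := no GKP
solution on a longer interval extends `(u, U)` (as in `GKPCriticalElementsPathSpace.lean`),
Prop. 2.2 reads: *for `p = 3·2^k - 2`, `k ≥ 2`, if `(u, U)` is a GKP solution on `[0, T)` with
`0 < T = T* < ∞` whose `sup_{[0,T)} ‖U t‖_{Ḃ^{s_p}_{p,p}}` is finite (`A_c < ∞`) and is `≤` that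
of every GKP solution with finite maximal time (`u 0 ∈ 𝒟_c`, by the `inf` formula for `A_c`),
then `U t → 0` in `𝓢'(ℝ³, ℂ³)` as `t → T⁻`.* This is hypothesis `hP` of
`gkp_criticalElement_tendsto_zero_of_pathSpace`, verbatim; data are function-valued and the
viscosity is general, as everywhere in this file family (GKP §2.4: time translates of critical
elements are critical elements, and they are smooth by (1.6); `ν ↦ 1` by scaling). It is not
vendored as a named fact here (this file adds no debt); its proof is GKP §2.4 and rests on Koch's
profile decomposition (Thm. 2), its Navier–Stokes evolution (Thm. 3, with App. A), the
orthogonality Prop. 2.6 and (2.12) — a theory absent from Mathlib and from this tree.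

## Verdict (2026-08-15) and the bundled vocabulary

On the strength of this audit the tree-class rendering `gkp_criticalElement_tendsto_zero` is
**deprecated as mis-stated** in `GKPCriticalElements.lean` (statement kept verbatim for its users),
exactly like `gkp_regularity_persistence` and `gkp_exists_criticalElement` before it; the faithful
statement is Prop. 2.2 over GKP's class. Since the verdict clean-up of that file GKP's class has a
*bundled* vocabulary there — `IsGKPSolutionOn p q T ν u U` (literally
`IsBesovMildSolutionOn ∧ MemGKPPathSpace`, `isGKPSolutionOn_iff_memGKPPathSpace` below),
`IsMaximalGKPSolution` ("`T = T*(u₀)`"), `gkpCriticalThreshold` (`A_c` as printed) and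
`IsGKPCriticalElement` (`𝒟_c` as printed) — in which the faithful Prop. 2.2 is the one-liner
`IsGKPCriticalElement ν p T u U → Tendsto U (𝓝[<] T) (𝓝 0)` (hypothesis `h` of
`gkp_criticalElement_tendsto_zero_of_identification` there, the wanted named fact
`gkp_criticalElement_tendsto_zero_pathSpace`). This file predates that vocabulary and states the
same proposition in *unbundled* (minimiser) form, hypothesis `hP` below; the two forms are proved
equivalent here (`isMaximalGKPSolution_iff_memGKPPathSpace`, `isGKPCriticalElement_iff_minimiser`,
`forall_isGKPCriticalElement_tendsto_iff_pathSpace`), with no identification hypothesis involved.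

## What this file proves

* `criticalBesovThreshold_eq_iInf_pathSpace` — under `hId`, `A_c` of the tree is the infimum of
  `sup_{[0,T)} ‖U t‖` over the GKP solutions with finite maximal time (GKP's second formula for
  `A_c`, read over GKP's class);
* `isCriticalElement_iff_pathSpace` — under `hId`, the tree's `𝒟_c` is `𝒟_c` over GKP's class
  (minimiser form: GKP solution, `T = T*`, finite `sup`, `sup` minimal);
* `isGKPSolutionOn_iff_memGKPPathSpace`, `isMaximalGKPSolution_iff_memGKPPathSpace`,
  `isGKPCriticalElement_iff_minimiser` — the bundled class of `GKPCriticalElements.lean` versus the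
  unbundled one of the audit files (no hypothesis), and
  `forall_isGKPCriticalElement_tendsto_iff_pathSpace` — Prop. 2.2 over `IsGKPCriticalElement` is
  Prop. 2.2 in the minimiser form `hP`;
* `gkp_criticalElement_tendsto_zero_of_pathSpace : hP → hId → gkp_criticalElement_tendsto_zero` —
  the vendored Prop. 2.2 is the printed one over GKP's class **plus** the identification;
* the model-independent last step of §2.4 (p. 9: "for any such sequence `(s_n)` we can find a
  subsequence along which `u_c(s_n)` goes weakly to zero … which proves Proposition 2.2"):
  `tendsto_nhdsLT_of_forall_seq_exists_subseq` (a function has limit `x` at `T⁻` as soon as every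
  sequence `s_n → T`, `s_n < T`, has a subsequence along which it tends to `x`; Mathlib's
  `Filter.tendsto_of_subseq_tendsto` on the countably generated filter `𝓝[<] T`) and its refinement
  to strictly increasing sequences `s_n ↗ T`, `tendsto_nhdsLT_of_forall_strictMono`
  (`exists_strictMono_subseq_of_tendsto_of_lt`: a sequence `s_n < T`, `s_n → T`, has a strictly
  increasing subsequence);
* the model-independent first step of §2.4 (p. 8: "`u_{0,n} := u_c(s_n)` … is a bounded sequence
  in `Ḃ^{s_p}_{p,p}` … `φ_{j₀}` is the weak limit of `u_{0,n}`"): along any sequence of times in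
  `[0, T)` the slices of a family bounded in `Ḃ^{s_p}_{p,p}`, `3 < p < ∞`, have weak-* convergent
  subsequences in `𝓢'` (`exists_strictMono_tendsto_slice_of_biSup_lt_top`, from the sequential
  Banach–Alaoglu theorem for Besov-bounded sequences,
  `Literature.Analysis.FunctionSpaces.exists_strictMono_tendsto_of_memHomBesov`,
  `BesovWeakStarCompactness.lean`; versions for Besov mild solutions and for critical elements of
  either class, `IsBesovMildSolutionOn.exists_strictMono_tendsto_slice`,
  `IsCriticalElement.exists_strictMono_tendsto_slice`,
  `IsGKPCriticalElement.exists_strictMono_tendsto_slice`), and the resulting **reduction of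
  Prop. 2.2 to its profile-decomposition core** (p. 8: "To prove the proposition we need to show
  that `φ_{j₀} ≡ 0`"): `tendsto_zero_of_forall_weakLimit_eq_zero` — if every weak-* limit point of
  `(U (s_n))` along every strictly increasing `s_n ↗ T` vanishes, then `U t → 0` in `𝓢'` as
  `t ↗ T` — and its specialisations `IsCriticalElement.tendsto_zero_of_forall_weakLimit_eq_zero`,
  `IsGKPCriticalElement.tendsto_zero_of_forall_weakLimit_eq_zero`; and the last line of §2.4
  ("`‖φ_{j₀}‖_{Ḃ^{s_q}_{q,q}} ≲ ε` for all `ε`. Hence `φ_{j₀} = 0`"):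
  `eq_zero_of_eHomBesovNorm_critical_eq_zero` (a realised distribution with vanishing
  `Ḃ^{s_p}_{p,r}` norm, `3 < p < ∞`, `r ≠ 0`, is zero — the pairing bound of `BesovPairing.lean`).
  What remains of §2.4 after this file is exactly the statement that those weak limit points
  vanish, whose printed proof is the `NS`-evolution of the profile decomposition (Thm. 3),
  Prop. 2.6 and the orthogonality (2.12).

## References

* I. Gallagher, G. S. Koch, F. Planchon, *Blow-up of critical Besov norms at a potential
  Navier–Stokes singularity*, Comm. Math. Phys. 343 (2016) 39–82 = arXiv:1407.4156: p. 4 ((1.2),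
  (1.3), existence and uniqueness of `NS(u₀)` in `𝓛^{1:∞}_{p,q}(T)`), §2.1 p. 6 (`A_c`, `𝒟_c`,
  Prop. 2.2), §2.4 pp. 8–9 (proof of Prop. 2.2). [cite: GKP2016, Prop. 2.2]
* M. Fujii, *Sharp non-uniqueness for the Navier–Stokes equations in scaling critical spaces*,
  arXiv:2602.19846 (2026), Thm. 1.2, Rem. 1.3. [cite: Fujii2026, Thm. 1.2]
* H. Miura, *Remark on uniqueness of mild solutions to the Navier–Stokes equations*, J. Funct.
  Anal. 218 (2005) 110–129, Thm. 2.3. [cite: Miura2005, Thm. 2.3]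
-/

noncomputable section

open MeasureTheory TemperedDistribution Set Function Filter Topology
open scoped SchwartzMap ENNReal NNReal

namespace Literature.Analysis.FluidPDE

/-! ## `A_c` and `𝒟_c` of the tree versus `A_c` and `𝒟_c` over GKP's class -/

section Threshold

variable {ν : ℝ} {p : ℝ≥0∞} [Fact (1 ≤ p)]

/-- **GKP's second formula for `A_c`, over GKP's class.** Under the identification `hId` (every
Besov mild solution of the class `(s_p, p, p)` lies in `𝓛^{1:∞}_p[T' < T]`; audited in
`GKPRegularityPersistence.lean`, not a published result), the tree's threshold
`A_c = inf {sup_{[0,T)} ‖U t‖ | (u, U) maximal with finite lifespan T}`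
(`criticalBesovThreshold_eq_iInf`) is the same infimum taken over the GKP solutions
(`IsBesovMildSolutionOn ∧ MemGKPPathSpace`) with finite maximal time `T = T*` (no GKP solution on a
longer interval extends them) — GKP 2016, §2.1:
`A_c = inf {sup_{[0,T*(u₀))} ‖NS(u₀)(t)‖ | T*(u₀) < ∞}`, since under `hId` the two maximality
notions coincide (`isMaximalBesovMildSolution_iff_pathSpace`). [cite: GKP2016, §2.1] -/
theorem criticalBesovThreshold_eq_iInf_pathSpace
    (hId : ∀ ⦃T' : ℝ⦄, 0 < T' →
      ∀ ⦃v : ℝ → EuclideanSpace ℝ (Fin 3) → EuclideanSpace ℝ (Fin 3)⦄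
        ⦃V : ℝ → 𝓢'(EuclideanSpace ℝ (Fin 3), EuclideanSpace ℂ (Fin 3))⦄,
        IsBesovMildSolutionOn (-1 + 3 / p.toReal) p p T' ν v V → MemGKPPathSpace p p T' V) :
    criticalBesovThreshold ν p =
      ⨅ (T : ℝ) (u : ℝ → EuclideanSpace ℝ (Fin 3) → EuclideanSpace ℝ (Fin 3))
        (U : ℝ → 𝓢'(EuclideanSpace ℝ (Fin 3), EuclideanSpace ℂ (Fin 3))) (_ : 0 < T)
        (_ : IsBesovMildSolutionOn (-1 + 3 / p.toReal) p p T ν u U ∧ MemGKPPathSpace p p T U ∧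
          ¬ ∃ T' > T, ∃ (v : ℝ → EuclideanSpace ℝ (Fin 3) → EuclideanSpace ℝ (Fin 3))
              (V : ℝ → 𝓢'(EuclideanSpace ℝ (Fin 3), EuclideanSpace ℂ (Fin 3))),
            (IsBesovMildSolutionOn (-1 + 3 / p.toReal) p p T' ν v V ∧ MemGKPPathSpace p p T' V) ∧
              ∀ t ∈ Ico 0 T, v t =ᵐ[volume] u t),
        ⨆ t ∈ Ico 0 T, FunctionSpaces.eHomBesovNorm (-1 + 3 / p.toReal) p p (U t) := by
  rw [criticalBesovThreshold_eq_iInf]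
  refine iInf_congr fun T => iInf_congr fun u => iInf_congr fun U => iInf_congr fun hT => ?_
  exact iInf_congr_Prop (isMaximalBesovMildSolution_iff_pathSpace hId hT) fun _ => rfl

/-- **`𝒟_c` of the tree = `𝒟_c` over GKP's class, under the identification.** Granted `hId`,
`(u, U)` is a critical element of the tree (`IsCriticalElement ν p T u U`: maximal with finite
lifespan `0 < T`, `sup_{[0,T)} ‖U t‖ = A_c < ∞`) iff it is a GKP solution on `[0, T)`, `0 < T`,
with no GKP extension (`T = T*(u 0) < ∞`), finite `sup_{[0,T)} ‖U t‖_{Ḃ^{s_p}_{p,p}}`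
(`A_c < ∞`), and `sup` not exceeding that of any GKP solution with finite maximal time — i.e.
`u 0 ∈ 𝒟_c` in the sense of GKP 2016, §2.1 with the `inf` formula for `A_c` (the inequality
`sup ≥ A_c` being automatic, `criticalBesovThreshold_le_biSup`). [cite: GKP2016, §2.1] -/
theorem isCriticalElement_iff_pathSpace
    (hId : ∀ ⦃T' : ℝ⦄, 0 < T' →
      ∀ ⦃v : ℝ → EuclideanSpace ℝ (Fin 3) → EuclideanSpace ℝ (Fin 3)⦄
        ⦃V : ℝ → 𝓢'(EuclideanSpace ℝ (Fin 3), EuclideanSpace ℂ (Fin 3))⦄,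
        IsBesovMildSolutionOn (-1 + 3 / p.toReal) p p T' ν v V → MemGKPPathSpace p p T' V)
    {T : ℝ} {u : ℝ → EuclideanSpace ℝ (Fin 3) → EuclideanSpace ℝ (Fin 3)}
    {U : ℝ → 𝓢'(EuclideanSpace ℝ (Fin 3), EuclideanSpace ℂ (Fin 3))} :
    IsCriticalElement ν p T u U ↔
      0 < T ∧
        (IsBesovMildSolutionOn (-1 + 3 / p.toReal) p p T ν u U ∧ MemGKPPathSpace p p T U ∧
          ¬ ∃ T' > T, ∃ (v : ℝ → EuclideanSpace ℝ (Fin 3) → EuclideanSpace ℝ (Fin 3))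
              (V : ℝ → 𝓢'(EuclideanSpace ℝ (Fin 3), EuclideanSpace ℂ (Fin 3))),
            (IsBesovMildSolutionOn (-1 + 3 / p.toReal) p p T' ν v V ∧ MemGKPPathSpace p p T' V) ∧
              ∀ t ∈ Ico 0 T, v t =ᵐ[volume] u t) ∧
        ⨆ t ∈ Ico 0 T, FunctionSpaces.eHomBesovNorm (-1 + 3 / p.toReal) p p (U t) < ∞ ∧
        ∀ ⦃T₁ : ℝ⦄ ⦃u₁ : ℝ → EuclideanSpace ℝ (Fin 3) → EuclideanSpace ℝ (Fin 3)⦄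
          ⦃U₁ : ℝ → 𝓢'(EuclideanSpace ℝ (Fin 3), EuclideanSpace ℂ (Fin 3))⦄, 0 < T₁ →
          IsBesovMildSolutionOn (-1 + 3 / p.toReal) p p T₁ ν u₁ U₁ → MemGKPPathSpace p p T₁ U₁ →
          (¬ ∃ T' > T₁, ∃ (v : ℝ → EuclideanSpace ℝ (Fin 3) → EuclideanSpace ℝ (Fin 3))
              (V : ℝ → 𝓢'(EuclideanSpace ℝ (Fin 3), EuclideanSpace ℂ (Fin 3))),
              (IsBesovMildSolutionOn (-1 + 3 / p.toReal) p p T' ν v V ∧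
                  MemGKPPathSpace p p T' V) ∧
                ∀ t ∈ Ico 0 T₁, v t =ᵐ[volume] u₁ t) →
          ⨆ t ∈ Ico 0 T, FunctionSpaces.eHomBesovNorm (-1 + 3 / p.toReal) p p (U t) ≤
            ⨆ t ∈ Ico 0 T₁, FunctionSpaces.eHomBesovNorm (-1 + 3 / p.toReal) p p (U₁ t) := by
  constructor
  · intro h
    refine ⟨h.pos, (isMaximalBesovMildSolution_iff_pathSpace hId h.pos).1 h.isMaximal,
      h.biSup_lt_top, fun T₁ u₁ U₁ hT₁ hu₁ _ hno₁ => ?_⟩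
    rw [h.biSup_eq]
    exact criticalBesovThreshold_le_biSup hT₁
      (isMaximalBesovMildSolution_of_not_exists_extension_pathSpace hId hT₁ hu₁ hno₁)
  · rintro ⟨hT, hGKP, hlt, hmin⟩
    have hmax : IsMaximalBesovMildSolution (-1 + 3 / p.toReal) p p T ν u U :=
      (isMaximalBesovMildSolution_iff_pathSpace hId hT).2 hGKP
    refine IsCriticalElement.of_biSup_le hT hmax ?_
      ((criticalBesovThreshold_le_biSup hT hmax).trans_lt hlt)
    rw [criticalBesovThreshold_eq_iInf]
    exact le_iInf fun T₁ => le_iInf fun u₁ => le_iInf fun U₁ => le_iInf fun hT₁ =>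
      le_iInf fun hmax₁ => hmin hT₁ hmax₁.isBesovMildSolutionOn
        (hId hT₁ hmax₁.isBesovMildSolutionOn) hmax₁.not_exists_extension_pathSpace

end Threshold

/-! ## The vendored Proposition 2.2 = the printed one over GKP's class + the identification -/

section Prop22

-- `linter.deprecated` is switched off for the next declaration only: its conclusion is the
-- tree-class rendering `gkp_criticalElement_tendsto_zero`, deprecated as mis-stated (2026-08-15,
-- verdict of this audit) in `GKPCriticalElements.lean`; this theorem is the unfolded form of that
-- verdict (vendored fact = printed Prop. 2.2 over GKP's class + identification) and is used by
-- `gkp_besov_blowup_of_pathSpace` (`GKPRigidityProofs.lean`), so it is kept verbatim.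
set_option linter.deprecated false in
/-- **`gkp_criticalElement_tendsto_zero` = Prop. 2.2 over GKP's class `𝓛^{1:∞}_p[T' < T]` + the
identification of the tree's class with `NS(u₀)`.** Hypothesis `hP` is GKP 2016, Prop. 2.2
("if `A_c < ∞`, then any `u₀` in `𝒟_c` satisfies `NS(u₀)(t) → 0` in `𝓢'` as `t ↗ T*(u₀)`")
transported to Gallagher–Koch–Planchon's own solution class (module docstring, §"The statement
over GKP's class"): with "GKP solution on `[0, T)`" = Besov mild solution of the class
`(s_p, p, p)` lying in `𝓛^{1:∞}_p[T' < T]` (`MemGKPPathSpace p p T U`) and "`T = T*`" = no GKP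
solution on a longer interval extends it, *for `p = 3·2^k - 2`, `k ≥ 2`, a GKP solution `(u, U)`
on `[0, T)`, `0 < T = T* < ∞`, with finite `sup_{[0,T)} ‖U t‖_{Ḃ^{s_p}_{p,p}}` (`A_c < ∞`) not
exceeding that of any GKP solution with finite maximal time (`u 0 ∈ 𝒟_c`) satisfies `U t → 0` in
`𝓢'(ℝ³, ℂ³)` (weak-* topology) as `t → T⁻`*, for any viscosity `ν > 0`. Hypothesis `hId` is the
standing identification of `CriticalRegularity.lean` in the form used by
`gkp_regularity_persistence_of_pathSpace` and `gkp_exists_criticalElement_of_pathSpace` — every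
`IsBesovMildSolutionOn` solution lies in GKP's path space — which is **not** a published result
and is not asserted here. Together they give the vendored `gkp_criticalElement_tendsto_zero`: a
critical element of the tree is, under `hId`, a member of `𝒟_c` over GKP's class
(`isCriticalElement_iff_pathSpace`), to which `hP` applies. [cite: GKP2016, Prop. 2.2] -/
theorem gkp_criticalElement_tendsto_zero_of_pathSpace
    (hP : ∀ ⦃ν : ℝ⦄, 0 < ν → ∀ ⦃p : ℝ≥0∞⦄ [Fact (1 ≤ p)], IsGKPExponent p →
      ∀ ⦃T : ℝ⦄ ⦃u : ℝ → EuclideanSpace ℝ (Fin 3) → EuclideanSpace ℝ (Fin 3)⦄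
        ⦃U : ℝ → 𝓢'(EuclideanSpace ℝ (Fin 3), EuclideanSpace ℂ (Fin 3))⦄, 0 < T →
        IsBesovMildSolutionOn (-1 + 3 / p.toReal) p p T ν u U → MemGKPPathSpace p p T U →
        (¬ ∃ T' > T, ∃ (v : ℝ → EuclideanSpace ℝ (Fin 3) → EuclideanSpace ℝ (Fin 3))
            (V : ℝ → 𝓢'(EuclideanSpace ℝ (Fin 3), EuclideanSpace ℂ (Fin 3))),
            (IsBesovMildSolutionOn (-1 + 3 / p.toReal) p p T' ν v V ∧ MemGKPPathSpace p p T' V) ∧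
              ∀ t ∈ Ico 0 T, v t =ᵐ[volume] u t) →
        ⨆ t ∈ Ico 0 T, FunctionSpaces.eHomBesovNorm (-1 + 3 / p.toReal) p p (U t) < ∞ →
        (∀ ⦃T₁ : ℝ⦄ ⦃u₁ : ℝ → EuclideanSpace ℝ (Fin 3) → EuclideanSpace ℝ (Fin 3)⦄
            ⦃U₁ : ℝ → 𝓢'(EuclideanSpace ℝ (Fin 3), EuclideanSpace ℂ (Fin 3))⦄, 0 < T₁ →
            IsBesovMildSolutionOn (-1 + 3 / p.toReal) p p T₁ ν u₁ U₁ →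
            MemGKPPathSpace p p T₁ U₁ →
            (¬ ∃ T' > T₁, ∃ (v : ℝ → EuclideanSpace ℝ (Fin 3) → EuclideanSpace ℝ (Fin 3))
                (V : ℝ → 𝓢'(EuclideanSpace ℝ (Fin 3), EuclideanSpace ℂ (Fin 3))),
                (IsBesovMildSolutionOn (-1 + 3 / p.toReal) p p T' ν v V ∧
                    MemGKPPathSpace p p T' V) ∧
                  ∀ t ∈ Ico 0 T₁, v t =ᵐ[volume] u₁ t) →
            ⨆ t ∈ Ico 0 T, FunctionSpaces.eHomBesovNorm (-1 + 3 / p.toReal) p p (U t) ≤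
              ⨆ t ∈ Ico 0 T₁, FunctionSpaces.eHomBesovNorm (-1 + 3 / p.toReal) p p (U₁ t)) →
        Tendsto U (𝓝[<] T) (𝓝 0))
    (hId : ∀ ⦃ν : ℝ⦄, 0 < ν → ∀ ⦃p q : ℝ≥0∞⦄ [Fact (1 ≤ p)], 3 < p → p < ∞ → 3 < q → q < ∞ →
      ∀ ⦃T : ℝ⦄, 0 < T → ∀ ⦃u : ℝ → EuclideanSpace ℝ (Fin 3) → EuclideanSpace ℝ (Fin 3)⦄
        ⦃U : ℝ → 𝓢'(EuclideanSpace ℝ (Fin 3), EuclideanSpace ℂ (Fin 3))⦄,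
        IsBesovMildSolutionOn (-1 + 3 / p.toReal) p q T ν u U → MemGKPPathSpace p q T U) :
    gkp_criticalElement_tendsto_zero := by
  intro ν hν p _ hp T u U hc
  -- the identification, specialised to the diagonal class `(s_p, p, p)` at this `(ν, p)`
  have hId' : ∀ ⦃T' : ℝ⦄, 0 < T' →
      ∀ ⦃v : ℝ → EuclideanSpace ℝ (Fin 3) → EuclideanSpace ℝ (Fin 3)⦄
        ⦃V : ℝ → 𝓢'(EuclideanSpace ℝ (Fin 3), EuclideanSpace ℂ (Fin 3))⦄,
        IsBesovMildSolutionOn (-1 + 3 / p.toReal) p p T' ν v V → MemGKPPathSpace p p T' V :=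
    fun T' hT' v V hv => hId hν hp.three_lt hp.lt_top hp.three_lt hp.lt_top hT' hv
  -- a critical element of the tree is a member of `𝒟_c` over GKP's class; apply Prop. 2.2 there
  obtain ⟨hT, ⟨hu, hU, hno⟩, hlt, hmin⟩ := (isCriticalElement_iff_pathSpace hId').1 hc
  exact hP hν hp hT hu hU hno hlt hmin

end Prop22

/-! ## The bundled class of `GKPCriticalElements.lean` versus the unbundled one of the audit files -/

section Bundled

variable {ν : ℝ} {p q : ℝ≥0∞} [Fact (1 ≤ p)] {T : ℝ}
  {u : ℝ → EuclideanSpace ℝ (Fin 3) → EuclideanSpace ℝ (Fin 3)}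
  {U : ℝ → 𝓢'(EuclideanSpace ℝ (Fin 3), EuclideanSpace ℂ (Fin 3))}

/-- **`IsGKPSolutionOn` unbundled**: a GKP solution on `[0, T)` in the sense of
`GKPCriticalElements.lean` is exactly a Besov mild solution of the class `(s_p, p, q)` lying in the
path space `𝓛^{1:∞}_{p,q}[T' < T]` (`MemGKPPathSpace`, GKP 2016, (1.5)–(1.6); the second clause
of the structure is `MemGKPPathSpace` unfolded, `memGKPPathSpace_iff`). [cite: GKP2016, (1.6)] -/
theorem isGKPSolutionOn_iff_memGKPPathSpace :
    IsGKPSolutionOn p q T ν u U ↔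
      IsBesovMildSolutionOn (-1 + 3 / p.toReal) p q T ν u U ∧ MemGKPPathSpace p q T U :=
  ⟨fun h => ⟨h.isBesovMildSolutionOn, h.pathNorm_lt_top⟩, fun h => ⟨h.1, h.2⟩⟩

/-- **`IsMaximalGKPSolution` unbundled** ("`T = T*(u₀)`", GKP 2016, (1.3)): a maximal GKP
solution is a Besov mild solution in the path space with no extension of the form "Besov mild
solution in the path space on a longer interval agreeing a.e. at every time of `[0, T)`" — the
triple used as "GKP solution with `T = T*`" throughout the audit files
(`GKPCriticalElementsPathSpace.lean`, this file, `GKPRigidityProofs.lean`,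
`CriticalRegularityPathSpace.lean`). [cite: GKP2016, (1.3)] -/
theorem isMaximalGKPSolution_iff_memGKPPathSpace :
    IsMaximalGKPSolution p q T ν u U ↔
      IsBesovMildSolutionOn (-1 + 3 / p.toReal) p q T ν u U ∧ MemGKPPathSpace p q T U ∧
        ¬ ∃ T' > T, ∃ (v : ℝ → EuclideanSpace ℝ (Fin 3) → EuclideanSpace ℝ (Fin 3))
            (V : ℝ → 𝓢'(EuclideanSpace ℝ (Fin 3), EuclideanSpace ℂ (Fin 3))),
          (IsBesovMildSolutionOn (-1 + 3 / p.toReal) p q T' ν v V ∧ MemGKPPathSpace p q T' V) ∧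
            ∀ t ∈ Ico 0 T, v t =ᵐ[volume] u t := by
  constructor
  · intro h
    refine ⟨h.isGKPSolutionOn.isBesovMildSolutionOn, h.isGKPSolutionOn.pathNorm_lt_top, ?_⟩
    rintro ⟨T', hT', v, V, hv, hvu⟩
    exact h.not_extendable ⟨T', hT', v, V, isGKPSolutionOn_iff_memGKPPathSpace.2 hv, hvu⟩
  · rintro ⟨hu, hU, hno⟩
    refine ⟨isGKPSolutionOn_iff_memGKPPathSpace.2 ⟨hu, hU⟩, ?_⟩
    rintro ⟨T', hT', v, V, hv, hvu⟩
    exact hno ⟨T', hT', v, V, isGKPSolutionOn_iff_memGKPPathSpace.1 hv, hvu⟩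

/-- **`𝒟_c` as printed, in minimiser form** (GKP 2016, §2.1 with the second formula
`A_c = inf {sup_{[0,T*(u₀))} ‖NS(u₀)(t)‖ | T*(u₀) < ∞}`, `gkpCriticalThreshold_eq_iInf`): `(u, U)`
is a GKP critical element with lifespan `T` (`IsGKPCriticalElement ν p T u U`: maximal GKP
solution, `0 < T`, `sup_{[0,T)} ‖U t‖ = A_c < ∞`) iff `0 < T`, `(u, U)` is a Besov mild solution in
the path space with no such extension (`T = T*`), its `sup_{[0,T)} ‖U t‖_{Ḃ^{s_p}_{p,p}}` is finite,
and that `sup` does not exceed the `sup` of any other maximal GKP solution with finite lifespan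
(the inequality `sup ≥ A_c` being automatic, `gkpCriticalThreshold_le_biSup`; closing step of
§2.3, `IsGKPCriticalElement.of_biSup_le`). No identification hypothesis: this is a statement inside
GKP's class. [cite: GKP2016, §2.1] -/
theorem isGKPCriticalElement_iff_minimiser :
    IsGKPCriticalElement ν p T u U ↔
      0 < T ∧
        (IsBesovMildSolutionOn (-1 + 3 / p.toReal) p p T ν u U ∧ MemGKPPathSpace p p T U ∧
          ¬ ∃ T' > T, ∃ (v : ℝ → EuclideanSpace ℝ (Fin 3) → EuclideanSpace ℝ (Fin 3))
              (V : ℝ → 𝓢'(EuclideanSpace ℝ (Fin 3), EuclideanSpace ℂ (Fin 3))),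
            (IsBesovMildSolutionOn (-1 + 3 / p.toReal) p p T' ν v V ∧ MemGKPPathSpace p p T' V) ∧
              ∀ t ∈ Ico 0 T, v t =ᵐ[volume] u t) ∧
        ⨆ t ∈ Ico 0 T, FunctionSpaces.eHomBesovNorm (-1 + 3 / p.toReal) p p (U t) < ∞ ∧
        ∀ ⦃T₁ : ℝ⦄ ⦃u₁ : ℝ → EuclideanSpace ℝ (Fin 3) → EuclideanSpace ℝ (Fin 3)⦄
          ⦃U₁ : ℝ → 𝓢'(EuclideanSpace ℝ (Fin 3), EuclideanSpace ℂ (Fin 3))⦄, 0 < T₁ →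
          IsBesovMildSolutionOn (-1 + 3 / p.toReal) p p T₁ ν u₁ U₁ → MemGKPPathSpace p p T₁ U₁ →
          (¬ ∃ T' > T₁, ∃ (v : ℝ → EuclideanSpace ℝ (Fin 3) → EuclideanSpace ℝ (Fin 3))
              (V : ℝ → 𝓢'(EuclideanSpace ℝ (Fin 3), EuclideanSpace ℂ (Fin 3))),
              (IsBesovMildSolutionOn (-1 + 3 / p.toReal) p p T' ν v V ∧
                  MemGKPPathSpace p p T' V) ∧
                ∀ t ∈ Ico 0 T₁, v t =ᵐ[volume] u₁ t) →
          ⨆ t ∈ Ico 0 T, FunctionSpaces.eHomBesovNorm (-1 + 3 / p.toReal) p p (U t) ≤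
            ⨆ t ∈ Ico 0 T₁, FunctionSpaces.eHomBesovNorm (-1 + 3 / p.toReal) p p (U₁ t) := by
  constructor
  · intro h
    refine ⟨h.pos, isMaximalGKPSolution_iff_memGKPPathSpace.1 h.isMaximal, h.biSup_lt_top,
      fun T₁ u₁ U₁ hT₁ hu₁ hU₁ hno₁ => ?_⟩
    rw [h.biSup_eq]
    exact gkpCriticalThreshold_le_biSup hT₁
      (isMaximalGKPSolution_iff_memGKPPathSpace.2 ⟨hu₁, hU₁, hno₁⟩)
  · rintro ⟨hT, hGKP, hlt, hmin⟩
    have hmax : IsMaximalGKPSolution p p T ν u U := isMaximalGKPSolution_iff_memGKPPathSpace.2 hGKP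
    refine IsGKPCriticalElement.of_biSup_le hT hmax ?_ ((gkpCriticalThreshold_le_biSup hT hmax).trans_lt hlt)
    rw [gkpCriticalThreshold_eq_iInf]
    refine le_iInf fun T₁ => le_iInf fun u₁ => le_iInf fun U₁ => le_iInf fun hT₁ =>
      le_iInf fun hmax₁ => ?_
    obtain ⟨hu₁, hU₁, hno₁⟩ := isMaximalGKPSolution_iff_memGKPPathSpace.1 hmax₁
    exact hmin hT₁ hu₁ hU₁ hno₁

/-- **Prop. 2.2 over GKP's class: bundled form = minimiser form.** The faithful Proposition 2.2
(GKP 2016, §2.1 p. 6: "if `A_c < ∞`, then any `u₀` in `𝒟_c` satisfies `NS(u₀)(t) → 0` in `𝓢'` as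
`t ↗ T*(u₀)`") stated over `IsGKPCriticalElement` — hypothesis `h` of
`gkp_criticalElement_tendsto_zero_of_identification` (`GKPCriticalElements.lean`), the wanted named
fact `gkp_criticalElement_tendsto_zero_pathSpace` — is equivalent to the same proposition in the
unbundled minimiser form, hypothesis `hP` of `gkp_criticalElement_tendsto_zero_of_pathSpace` (this
file), by `isGKPCriticalElement_iff_minimiser`; no identification hypothesis is involved.
[cite: GKP2016, Prop. 2.2] -/
theorem forall_isGKPCriticalElement_tendsto_iff_pathSpace :
    (∀ ⦃ν : ℝ⦄, 0 < ν → ∀ ⦃p : ℝ≥0∞⦄ [Fact (1 ≤ p)], IsGKPExponent p → ∀ ⦃T : ℝ⦄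
      ⦃u : ℝ → EuclideanSpace ℝ (Fin 3) → EuclideanSpace ℝ (Fin 3)⦄
      ⦃U : ℝ → 𝓢'(EuclideanSpace ℝ (Fin 3), EuclideanSpace ℂ (Fin 3))⦄,
      IsGKPCriticalElement ν p T u U → Tendsto U (𝓝[<] T) (𝓝 0)) ↔
    (∀ ⦃ν : ℝ⦄, 0 < ν → ∀ ⦃p : ℝ≥0∞⦄ [Fact (1 ≤ p)], IsGKPExponent p →
      ∀ ⦃T : ℝ⦄ ⦃u : ℝ → EuclideanSpace ℝ (Fin 3) → EuclideanSpace ℝ (Fin 3)⦄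
        ⦃U : ℝ → 𝓢'(EuclideanSpace ℝ (Fin 3), EuclideanSpace ℂ (Fin 3))⦄, 0 < T →
        IsBesovMildSolutionOn (-1 + 3 / p.toReal) p p T ν u U → MemGKPPathSpace p p T U →
        (¬ ∃ T' > T, ∃ (v : ℝ → EuclideanSpace ℝ (Fin 3) → EuclideanSpace ℝ (Fin 3))
            (V : ℝ → 𝓢'(EuclideanSpace ℝ (Fin 3), EuclideanSpace ℂ (Fin 3))),
            (IsBesovMildSolutionOn (-1 + 3 / p.toReal) p p T' ν v V ∧ MemGKPPathSpace p p T' V) ∧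
              ∀ t ∈ Ico 0 T, v t =ᵐ[volume] u t) →
        ⨆ t ∈ Ico 0 T, FunctionSpaces.eHomBesovNorm (-1 + 3 / p.toReal) p p (U t) < ∞ →
        (∀ ⦃T₁ : ℝ⦄ ⦃u₁ : ℝ → EuclideanSpace ℝ (Fin 3) → EuclideanSpace ℝ (Fin 3)⦄
            ⦃U₁ : ℝ → 𝓢'(EuclideanSpace ℝ (Fin 3), EuclideanSpace ℂ (Fin 3))⦄, 0 < T₁ →
            IsBesovMildSolutionOn (-1 + 3 / p.toReal) p p T₁ ν u₁ U₁ →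
            MemGKPPathSpace p p T₁ U₁ →
            (¬ ∃ T' > T₁, ∃ (v : ℝ → EuclideanSpace ℝ (Fin 3) → EuclideanSpace ℝ (Fin 3))
                (V : ℝ → 𝓢'(EuclideanSpace ℝ (Fin 3), EuclideanSpace ℂ (Fin 3))),
                (IsBesovMildSolutionOn (-1 + 3 / p.toReal) p p T' ν v V ∧
                    MemGKPPathSpace p p T' V) ∧
                  ∀ t ∈ Ico 0 T₁, v t =ᵐ[volume] u₁ t) →
            ⨆ t ∈ Ico 0 T, FunctionSpaces.eHomBesovNorm (-1 + 3 / p.toReal) p p (U t) ≤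
              ⨆ t ∈ Ico 0 T₁, FunctionSpaces.eHomBesovNorm (-1 + 3 / p.toReal) p p (U₁ t)) →
        Tendsto U (𝓝[<] T) (𝓝 0)) := by
  constructor
  · intro h ν hν p _ hp T u U hT hu hU hno hlt hmin
    exact h hν hp (isGKPCriticalElement_iff_minimiser.2 ⟨hT, ⟨hu, hU, hno⟩, hlt, hmin⟩)
  · intro h ν hν p _ hp T u U hc
    obtain ⟨hT, ⟨hu, hU, hno⟩, hlt, hmin⟩ := isGKPCriticalElement_iff_minimiser.1 hc
    exact h hν hp hT hu hU hno hlt hmin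

end Bundled

/-! ## The last step of §2.4: weak convergence at `T*` from subsequences of sequences `s_n ↗ T*` -/

section Subsequence

/-- **Subsequence principle at a left endpoint** (the model-independent closing step of GKP 2016,
§2.4, p. 9: "for any such sequence `(s_n)` we can find a subsequence along which `u_c(s_n)` goes
weakly to zero … `u_c(t) ⇀ 0` as `t ↗ T*`"): a function `U` on `ℝ` with values in any topological
space tends to `x` as `t → T⁻` as soon as every sequence `s_n → T` with `s_n < T` has a subsequence
along which `U (s_n)` tends to `x` (the filter `𝓝[<] T` is countably generated; Mathlib's
`Filter.tendsto_of_subseq_tendsto`). [cite: GKP2016, §2.4] -/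
theorem tendsto_nhdsLT_of_forall_seq_exists_subseq {X : Type*} [TopologicalSpace X] {U : ℝ → X}
    {x : X} {T : ℝ}
    (h : ∀ s : ℕ → ℝ, (∀ n, s n < T) → Tendsto s atTop (𝓝 T) →
      ∃ φ : ℕ → ℕ, StrictMono φ ∧ Tendsto (U ∘ s ∘ φ) atTop (𝓝 x)) :
    Tendsto U (𝓝[<] T) (𝓝 x) := by
  refine tendsto_of_subseq_tendsto fun s hs => ?_
  -- a sequence tending to `T` within `(-∞, T)` is eventually `< T`; modify its head to be `< T`
  rw [tendsto_nhdsWithin_iff] at hs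
  obtain ⟨N, hN⟩ := eventually_atTop.1 hs.2
  -- the shifted sequence `n ↦ s (n + N)` is everywhere `< T` and still tends to `T`
  obtain ⟨φ, hφ, hlim⟩ := h (fun n => s (n + N)) (fun n => hN _ (Nat.le_add_left N n))
    (hs.1.comp (tendsto_add_atTop_nat N))
  exact ⟨fun n => φ n + N, hlim⟩

/-- **A sequence converging to `T` from below has a strictly increasing subsequence** (elementary:
`s_n < T` and `s_n → T` make `{k | s_k > s_m}` cofinite for every `m`, so indices can be chosen
recursively). [folklore] -/
theorem exists_strictMono_subseq_of_tendsto_of_lt {s : ℕ → ℝ} {T : ℝ} (hlt : ∀ n, s n < T)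
    (hs : Tendsto s atTop (𝓝 T)) :
    ∃ φ : ℕ → ℕ, StrictMono φ ∧ StrictMono (s ∘ φ) := by
  -- for every index `m` there is a later index `k` with `s k > s m`
  have hnext : ∀ m, ∃ k, m < k ∧ s m < s k := fun m => by
    have h1 : ∀ᶠ k in atTop, s m < s k := hs.eventually (lt_mem_nhds (hlt m))
    have h2 : ∀ᶠ k in atTop, m < k := eventually_gt_atTop m
    exact (h1.and h2).exists.imp fun k hk => ⟨hk.2, hk.1⟩
  choose g hg₁ hg₂ using hnext
  refine ⟨fun n => g^[n] 0, strictMono_nat_of_lt_succ fun n => ?_,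
    strictMono_nat_of_lt_succ fun n => ?_⟩
  · rw [Function.iterate_succ_apply']
    exact hg₁ _
  · simp only [Function.comp_apply, Function.iterate_succ_apply']
    exact hg₂ _

/-- **Subsequence principle with increasing sequences `s_n ↗ T`** (GKP 2016, §2.4, p. 8: "define
`s_n ↗ T*(u_{0,c})`"; p. 9: along a subsequence `u_c(s_n) ⇀ 0`, hence `u_c(t) ⇀ 0` as
`t ↗ T*`): it suffices to treat strictly increasing sequences `s_n < T`, `s_n → T`, since every
sequence `s_n < T`, `s_n → T` has a strictly increasing subsequence
(`exists_strictMono_subseq_of_tendsto_of_lt`) and a subsequence of a subsequence is a subsequence.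
[cite: GKP2016, §2.4] -/
theorem tendsto_nhdsLT_of_forall_strictMono {X : Type*} [TopologicalSpace X] {U : ℝ → X} {x : X}
    {T : ℝ}
    (h : ∀ s : ℕ → ℝ, StrictMono s → (∀ n, s n < T) → Tendsto s atTop (𝓝 T) →
      ∃ φ : ℕ → ℕ, StrictMono φ ∧ Tendsto (U ∘ s ∘ φ) atTop (𝓝 x)) :
    Tendsto U (𝓝[<] T) (𝓝 x) := by
  refine tendsto_nhdsLT_of_forall_seq_exists_subseq fun s hlt hs => ?_
  obtain ⟨ψ, hψ, hmono⟩ := exists_strictMono_subseq_of_tendsto_of_lt hlt hs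
  obtain ⟨φ, hφ, hlim⟩ := h (s ∘ ψ) hmono (fun n => hlt _) (hs.comp hψ.tendsto_atTop)
  exact ⟨ψ ∘ φ, hψ.comp hφ, hlim⟩

end Subsequence

/-! ## The first step of §2.4: weak limit points of the slices `u_c(s_n)`, and the reduction of Prop. 2.2 to their vanishing -/

section WeakLimits

variable {ν : ℝ} {p : ℝ≥0∞} [Fact (1 ≤ p)] {T : ℝ}
  {u : ℝ → EuclideanSpace ℝ (Fin 3) → EuclideanSpace ℝ (Fin 3)}
  {U : ℝ → 𝓢'(EuclideanSpace ℝ (Fin 3), EuclideanSpace ℂ (Fin 3))}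

/-- **Slices of a family bounded in `Ḃ^{s_p}_{p,p}` have weak-* convergent subsequences** (GKP
2016, §2.4, p. 8: "`u_{0,n} := u_c(s_n)` … satisfies the assumptions of Theorem 3" — it is bounded
in `Ḃ^{s_p}_{p,p}` by `A_c` — "… `φ_{j₀}` is the weak limit of `u_{0,n}`"; the extraction itself is
the first half of the Fatou property, BCD Thm. 2.25). For `3 < p < ∞`, if `U t ∈ Ḃ^{s_p}_{p,p}`
for `t ∈ [0, T)` with `sup_{[0,T)} ‖U t‖_{Ḃ^{s_p}_{p,p}} < ∞`, then along every sequence of times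
`s_n ∈ [0, T)` some subsequence `U (s (φ n))` converges in `𝓢'(ℝ³, ℂ³)`: the slices are realised,
`‖U t‖_{Ḃ^{s_p}_{p,∞}} ≤ ‖U t‖_{Ḃ^{s_p}_{p,p}}` (`eHomBesovNorm_exponent_antitone`), `s_p = -σ` with
`0 < σ = 1 - 3/p < 2`, and `Literature.Analysis.FunctionSpaces.exists_strictMono_tendsto_of_eHomBesovNorm_le`
applies. [cite: GKP2016, §2.4] -/
theorem exists_strictMono_tendsto_slice_of_biSup_lt_top (hp₃ : 3 < p) (hp : p < ∞)
    (hmem : ∀ t ∈ Ico 0 T, FunctionSpaces.MemHomBesov (-1 + 3 / p.toReal) p p (U t))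
    (hsup : ⨆ t ∈ Ico 0 T, FunctionSpaces.eHomBesovNorm (-1 + 3 / p.toReal) p p (U t) < ∞)
    {s : ℕ → ℝ} (hs : ∀ n, s n ∈ Ico 0 T) :
    ∃ (φ₀ : 𝓢'(EuclideanSpace ℝ (Fin 3), EuclideanSpace ℂ (Fin 3))) (φ : ℕ → ℕ), StrictMono φ ∧
      Tendsto (fun n => U (s (φ n))) atTop (𝓝 φ₀) := by
  -- the regularity index `s_p = -σ`, `0 < σ = 1 - 3/p < 2`
  have hp0 : p ≠ 0 := (lt_trans (by norm_num) hp₃).ne'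
  have htop : p ≠ ∞ := hp.ne
  have h3 : (3 : ℝ) < p.toReal := by
    have h := (ENNReal.toReal_lt_toReal (by norm_num) htop).2 hp₃
    simpa using h
  have hpos : 0 < p.toReal := lt_trans (by norm_num) h3
  set σ : ℝ := 1 - 3 / p.toReal with hσ_def
  have hσ : 0 < σ := by
    rw [hσ_def, sub_pos, div_lt_one hpos]
    exact h3
  have hσ2 : σ < 2 := by
    rw [hσ_def]
    have : 0 < 3 / p.toReal := div_pos (by norm_num) hpos
    linarith
  have hidx : (-1 + 3 / p.toReal) = -σ := by rw [hσ_def]; ring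
  -- the bound `M = sup_{[0,T)} ‖U t‖`, finite by hypothesis
  set M : ℝ≥0∞ := ⨆ t ∈ Ico 0 T, FunctionSpaces.eHomBesovNorm (-1 + 3 / p.toReal) p p (U t)
    with hM_def
  have hle : ∀ n, FunctionSpaces.eHomBesovNorm (-σ) p ∞ (U (s n)) ≤ M.toNNReal := fun n => by
    rw [ENNReal.coe_toNNReal hsup.ne, ← hidx]
    calc FunctionSpaces.eHomBesovNorm (-1 + 3 / p.toReal) p ∞ (U (s n))
        ≤ FunctionSpaces.eHomBesovNorm (-1 + 3 / p.toReal) p p (U (s n)) :=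
          eHomBesovNorm_exponent_antitone _ p hp0 le_top _
      _ ≤ M := le_iSup₂ (f := fun t (_ : t ∈ Ico 0 T) =>
          FunctionSpaces.eHomBesovNorm (-1 + 3 / p.toReal) p p (U t)) (s n) (hs n)
  have hreal : ∀ n, Tendsto (fun j : ℤ => FunctionSpaces.lowFreqCutoff j (U (s n))) atBot (𝓝 0) :=
    fun n => (hmem _ (hs n)).tendsto_lowFreqCutoff
  exact FunctionSpaces.exists_strictMono_tendsto_of_eHomBesovNorm_le
    (E := EuclideanSpace ℝ (Fin 3)) (F := EuclideanSpace ℂ (Fin 3)) p hσ hσ2 hreal hle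

/-- **Slices of a Besov mild solution with bounded critical norm have weak-* convergent
subsequences** (GKP 2016, §2.4, first step, for a solution of the tree's class
`IsBesovMildSolutionOn` in `C([0,T); Ḃ^{s_p}_{p,p})` with `sup_{[0,T)} ‖U t‖ < ∞`).
[cite: GKP2016, §2.4] -/
theorem IsBesovMildSolutionOn.exists_strictMono_tendsto_slice (hp₃ : 3 < p) (hp : p < ∞)
    (hu : IsBesovMildSolutionOn (-1 + 3 / p.toReal) p p T ν u U)
    (hsup : ⨆ t ∈ Ico 0 T, FunctionSpaces.eHomBesovNorm (-1 + 3 / p.toReal) p p (U t) < ∞)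
    {s : ℕ → ℝ} (hs : ∀ n, s n ∈ Ico 0 T) :
    ∃ (φ₀ : 𝓢'(EuclideanSpace ℝ (Fin 3), EuclideanSpace ℂ (Fin 3))) (φ : ℕ → ℕ), StrictMono φ ∧
      Tendsto (fun n => U (s (φ n))) atTop (𝓝 φ₀) :=
  exists_strictMono_tendsto_slice_of_biSup_lt_top hp₃ hp hu.continuousInHomBesovOn.1 hsup hs

-- `linter.deprecated` is not involved: `IsCriticalElement` itself is not deprecated (only the
-- fact `gkp_criticalElement_tendsto_zero` about it is).
/-- **`u_{0,n} := u_c(s_n)` has weak limit points** (GKP 2016, §2.4, p. 8, for a critical element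
of the tree's class: `sup_{[0,T)} ‖U t‖ = A_c < ∞`). [cite: GKP2016, §2.4] -/
theorem IsCriticalElement.exists_strictMono_tendsto_slice (hp : IsGKPExponent p)
    (hc : IsCriticalElement ν p T u U) {s : ℕ → ℝ} (hs : ∀ n, s n ∈ Ico 0 T) :
    ∃ (φ₀ : 𝓢'(EuclideanSpace ℝ (Fin 3), EuclideanSpace ℂ (Fin 3))) (φ : ℕ → ℕ), StrictMono φ ∧
      Tendsto (fun n => U (s (φ n))) atTop (𝓝 φ₀) :=
  hc.isMaximal.isBesovMildSolutionOn.exists_strictMono_tendsto_slice hp.three_lt hp.lt_top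
    hc.biSup_lt_top hs

/-- **`u_{0,n} := u_c(s_n)` has weak limit points, over GKP's class** (GKP 2016, §2.4, p. 8, for a
critical element as printed, `IsGKPCriticalElement`: `sup_{[0,T*)} ‖NS(u₀)(t)‖ = A_c < ∞`).
[cite: GKP2016, §2.4] -/
theorem IsGKPCriticalElement.exists_strictMono_tendsto_slice (hp : IsGKPExponent p)
    (hc : IsGKPCriticalElement ν p T u U) {s : ℕ → ℝ} (hs : ∀ n, s n ∈ Ico 0 T) :
    ∃ (φ₀ : 𝓢'(EuclideanSpace ℝ (Fin 3), EuclideanSpace ℂ (Fin 3))) (φ : ℕ → ℕ), StrictMono φ ∧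
      Tendsto (fun n => U (s (φ n))) atTop (𝓝 φ₀) :=
  hc.isMaximal.isGKPSolutionOn.isBesovMildSolutionOn.exists_strictMono_tendsto_slice hp.three_lt
    hp.lt_top hc.biSup_lt_top hs

/-- **Reduction of Prop. 2.2 to the vanishing of weak limit points** (GKP 2016, §2.4, p. 8:
"`φ_{j₀}` is the weak limit of `u_{0,n}` … To prove the proposition we need to show that
`φ_{j₀} ≡ 0`", and p. 9: "for any such sequence `(s_n)` we can find a subsequence along which
`u_c(s_n)` goes weakly to zero … `u_c(t) ⇀ 0` as `t ↗ T*`"). Let `U t ∈ Ḃ^{s_p}_{p,p}`,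
`3 < p < ∞`, be bounded on `[0, T)`, `0 < T`. If along every strictly increasing sequence of times
`s_n ∈ [0, T)` with `s_n → T` the only possible weak-* limit of `(U (s_n))` is `0` (applied to
subsequences, which are again such sequences: every weak-* limit point of `(U (s_n))` vanishes),
then `U t → 0` in `𝓢'(ℝ³, ℂ³)` as `t ↗ T`: along any such `s_n` a subsequence converges weakly-*
(`exists_strictMono_tendsto_slice_of_biSup_lt_top`), its limit vanishes by hypothesis, and the
subsequence principle `tendsto_nhdsLT_of_forall_strictMono` concludes. [cite: GKP2016, §2.4] -/
theorem tendsto_zero_of_forall_weakLimit_eq_zero (hp₃ : 3 < p) (hp : p < ∞) (hT : 0 < T)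
    (hmem : ∀ t ∈ Ico 0 T, FunctionSpaces.MemHomBesov (-1 + 3 / p.toReal) p p (U t))
    (hsup : ⨆ t ∈ Ico 0 T, FunctionSpaces.eHomBesovNorm (-1 + 3 / p.toReal) p p (U t) < ∞)
    (h : ∀ s : ℕ → ℝ, StrictMono s → (∀ n, s n ∈ Ico 0 T) → Tendsto s atTop (𝓝 T) →
      ∀ φ₀ : 𝓢'(EuclideanSpace ℝ (Fin 3), EuclideanSpace ℂ (Fin 3)),
        Tendsto (fun n => U (s n)) atTop (𝓝 φ₀) → φ₀ = 0) :
    Tendsto U (𝓝[<] T) (𝓝 0) := by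
  refine tendsto_nhdsLT_of_forall_strictMono fun s hsmono hlt hs => ?_
  -- the sequence is eventually nonnegative (`s_n → T > 0`); drop its head
  obtain ⟨N, hN⟩ := eventually_atTop.1 (hs.eventually (lt_mem_nhds hT))
  set s' : ℕ → ℝ := fun n => s (n + N) with hs'_def
  have hs'mono : StrictMono s' := fun a b hab => hsmono (Nat.add_lt_add_right hab N)
  have hs'mem : ∀ n, s' n ∈ Ico 0 T := fun n => ⟨(hN _ (Nat.le_add_left N n)).le, hlt _⟩
  have hs'lim : Tendsto s' atTop (𝓝 T) := hs.comp (tendsto_add_atTop_nat N)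
  -- a weak-* convergent subsequence of the slices along `s'`, whose limit vanishes
  obtain ⟨φ₀, φ, hφ, hconv⟩ := exists_strictMono_tendsto_slice_of_biSup_lt_top hp₃ hp hmem hsup hs'mem
  -- `s' ∘ φ` is again strictly increasing in `[0, T)` with limit `T`, so its weak-* limit vanishes
  have hzero : φ₀ = 0 :=
    h (s' ∘ φ) (hs'mono.comp hφ) (fun n => hs'mem _) (hs'lim.comp hφ.tendsto_atTop) φ₀ hconv
  subst hzero
  exact ⟨fun n => φ n + N, (hφ.add_const N), hconv⟩

/-- **Prop. 2.2 for a critical element of the tree's class, reduced to its profile-decomposition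
core** (GKP 2016, §2.4): a critical element `(u, U)` (`IsCriticalElement ν p T u U`) tends to `0`
in `𝓢'` at its blow-up time as soon as, along every `s_n ↗ T`, the weak-* limit points of
`(U (s_n))` vanish — the statement "`φ_{j₀} ≡ 0`" whose printed proof uses Thm. 3, Prop. 2.6 and
(2.12). [cite: GKP2016, §2.4] -/
theorem IsCriticalElement.tendsto_zero_of_forall_weakLimit_eq_zero (hp : IsGKPExponent p)
    (hc : IsCriticalElement ν p T u U)
    (h : ∀ s : ℕ → ℝ, StrictMono s → (∀ n, s n ∈ Ico 0 T) → Tendsto s atTop (𝓝 T) →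
      ∀ φ₀ : 𝓢'(EuclideanSpace ℝ (Fin 3), EuclideanSpace ℂ (Fin 3)),
        Tendsto (fun n => U (s n)) atTop (𝓝 φ₀) → φ₀ = 0) :
    Tendsto U (𝓝[<] T) (𝓝 0) :=
  Literature.Analysis.FluidPDE.tendsto_zero_of_forall_weakLimit_eq_zero hp.three_lt hp.lt_top
    hc.pos hc.isMaximal.isBesovMildSolutionOn.continuousInHomBesovOn.1 hc.biSup_lt_top h

/-- **Prop. 2.2 as printed (critical element of GKP's class), reduced to its profile-decomposition
core** (GKP 2016, §2.4): for `u₀ ∈ 𝒟_c` (`IsGKPCriticalElement ν p T u U`), `NS(u₀)(t) → 0` in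
`𝓢'` as `t ↗ T*` as soon as, along every `s_n ↗ T*`, the weak-* limit points of `(u_c(s_n))`
vanish ("`φ_{j₀} ≡ 0`"). [cite: GKP2016, §2.4] -/
theorem IsGKPCriticalElement.tendsto_zero_of_forall_weakLimit_eq_zero (hp : IsGKPExponent p)
    (hc : IsGKPCriticalElement ν p T u U)
    (h : ∀ s : ℕ → ℝ, StrictMono s → (∀ n, s n ∈ Ico 0 T) → Tendsto s atTop (𝓝 T) →
      ∀ φ₀ : 𝓢'(EuclideanSpace ℝ (Fin 3), EuclideanSpace ℂ (Fin 3)),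
        Tendsto (fun n => U (s n)) atTop (𝓝 φ₀) → φ₀ = 0) :
    Tendsto U (𝓝[<] T) (𝓝 0) :=
  Literature.Analysis.FluidPDE.tendsto_zero_of_forall_weakLimit_eq_zero hp.three_lt hp.lt_top
    hc.pos hc.isMaximal.isGKPSolutionOn.isBesovMildSolutionOn.continuousInHomBesovOn.1
    hc.biSup_lt_top h

/-- **A realised distribution with vanishing critical Besov norm is zero** (the last line of
GKP 2016, §2.4, p. 9: "`‖φ_{j₀}‖_{Ḃ^{s_q}_{q,q}} ≲ ε` … for all `ε`. Hence `φ_{j₀} = 0`"): for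
`3 < p < ∞` and any third index `r ≠ 0` (the `ℓ⁰` "norm" being `0` by convention), if
`Ṡ_j w → 0` as `j → -∞` and `‖w‖_{Ḃ^{s_p}_{p,r}} = 0`, then `w = 0` in `𝓢'(ℝ³, ℂ³)`. Indeed
`‖w‖_{Ḃ^{s_p}_{p,∞}} ≤ ‖w‖_{Ḃ^{s_p}_{p,r}} = 0` (`eHomBesovNorm_exponent_antitone`), and every
pairing is controlled by that norm, `‖⟨w, θ⟩‖ ≤ K_θ ‖w‖_{Ḃ^{-σ}_{p,∞}}` with
`σ = 1 - 3/p ∈ (0, 2)`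
(`Literature.Analysis.FunctionSpaces.exists_nnnorm_apply_le_mul_eHomBesovNorm`, BCD Prop. 2.27), so
all pairings vanish. [cite: GKP2016, §2.4] -/
theorem eq_zero_of_eHomBesovNorm_critical_eq_zero (hp₃ : 3 < p) (hp : p < ∞) {r : ℝ≥0∞}
    (hr : r ≠ 0) {w : 𝓢'(EuclideanSpace ℝ (Fin 3), EuclideanSpace ℂ (Fin 3))}
    (hreal : Tendsto (fun j : ℤ => FunctionSpaces.lowFreqCutoff j w) atBot (𝓝 0))
    (hzero : FunctionSpaces.eHomBesovNorm (-1 + 3 / p.toReal) p r w = 0) : w = 0 := by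
  -- the regularity index `s_p = -σ`, `0 < σ = 1 - 3/p < 2`
  have htop : p ≠ ∞ := hp.ne
  have h3 : (3 : ℝ) < p.toReal := by
    have h := (ENNReal.toReal_lt_toReal (by norm_num) htop).2 hp₃
    simpa using h
  have hpos : 0 < p.toReal := lt_trans (by norm_num) h3
  have hσ : 0 < 1 - 3 / p.toReal := by
    rw [sub_pos, div_lt_one hpos]
    exact h3
  have hσ2 : 1 - 3 / p.toReal < 2 := by
    have : 0 < 3 / p.toReal := div_pos (by norm_num) hpos
    linarith
  have hidx : (-1 + 3 / p.toReal) = -(1 - 3 / p.toReal) := by ring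
  -- the `Ḃ^{s_p}_{p,∞}` norm vanishes too
  have hzero' : FunctionSpaces.eHomBesovNorm (-(1 - 3 / p.toReal)) p ∞ w = 0 := by
    rw [← hidx]
    refine le_antisymm ?_ bot_le
    calc FunctionSpaces.eHomBesovNorm (-1 + 3 / p.toReal) p ∞ w
        ≤ FunctionSpaces.eHomBesovNorm (-1 + 3 / p.toReal) p r w :=
          eHomBesovNorm_exponent_antitone _ p hr le_top _
      _ = 0 := hzero
  -- every pairing vanishes
  haveI : p.HolderConjugate (1 - p⁻¹)⁻¹ :=
    ENNReal.HolderConjugate.inv_one_sub_inv' (Fact.out : 1 ≤ p)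
  ext θ
  obtain ⟨K, hK⟩ := FunctionSpaces.exists_nnnorm_apply_le_mul_eHomBesovNorm
    (E := EuclideanSpace ℝ (Fin 3)) (F := EuclideanSpace ℂ (Fin 3)) p (1 - p⁻¹)⁻¹ hσ hσ2 θ
  have h := hK w hreal
  rw [hzero', mul_zero, nonpos_iff_eq_zero, ENNReal.coe_eq_zero, nnnorm_eq_zero] at h
  simp [h]

end WeakLimits

end Literature.Analysis.FluidPDE
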